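import Literature.Probability.RandomPlanarGeometry.SAWAdsorptionDensity
import Literature.Probability.RandomPlanarGeometry.SAWAdsorptionLowTemperatureSeries
import HarnessLib

/-!
# The density of wall visits of the adsorbing half-plane walk on `ℤ²`, second order:
# `𝓔_±(a) = 1 − 2/a² − 3/a³ + O(a⁻⁴)`

Topic `Literature/Probability/RandomPlanarGeometry` (continues `SAWAdsorptionDensity.lean` — `Zd.rightDensity α = d⁺κ/dα = 𝓔_+(e^α)`,
`Zd.leftDensity α = 𝓔_-(e^α)`, `a²(1 − 𝓔_±(a)) → 2` — and `SAWAdsorptionLowTemperatureSeries.lean`, the certified window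
`a + 1/a + 1/a² − 1/a³ − 3/a⁴ ≤ e^{κ(a)} ≤ a + 1/a + 1/a² − 1/a³ − 3/a⁴ + 32/a⁵` (`Zd.fourth_order_le_adsRate`, `a ≥ 3`;
`Zd.adsRate_le_exact5`, `a ≥ 10`)).

Janse van Rensburg–Whittington 2013, §3.1 eq. (3.4) (arXiv:1307.6457 v4 p. 6) define the one-sided densities of visits
`𝓔_±(a) = a d^±κ/da` of the adsorbing walk; the tree's `SAWAdsorptionDensity.lean` proves `a²(1 − 𝓔_±(a)) → 2`. Here the next
term: chords of `κ` of length `h = log(1 + a⁻²)` (from `a` to `a + 1/a`, and from `a/(1 + a⁻²)` to `a`) evaluated on the window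
above give, with `x = 1/a` and explicit integer polynomials `pA, pN, pM, pD, pM₂` (the Taylor data of the window endpoints),

* `Zd.lowPsi_le : lowPsi(e^{−α}) ≤ e^{3α}(1 − d⁺κ/dα − 2e^{−2α})` and `Zd.le_upPsi : e^{3α}(1 − d⁻κ/dα − 2e^{−2α}) ≤ upPsi(e^{−α})`
  for `e^α ≥ 11`, where `lowPsi(0) = upPsi(0) = 3` and both are continuous at `0`;
* hence **`Zd.tendsto_exp_three_mul_rightDensity` / `…leftDensity`: `e^{3α}(1 − d^±κ/dα − 2e^{−2α}) → 3`**, and in the fugacity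
  **`Zd.tendsto_cube_mul_one_sub_rightDensity_log` / `…leftDensity_log`: `a³(1 − 𝓔_±(a) − 2/a²) → 3`** —
  **the fraction of monomers off the wall at low temperature is `2/a² + 3/a³ + o(a⁻³)`**, matching term by term the derivative of
  the free-energy expansion `κ(α) = α + e^{−2α} + e^{−3α} + O(e^{−4α})`.

Label: NEW-IN-WRITING modest (explicit low-temperature law of the order parameter on `ℤ²`, from the lane's series). Axioms: standard
plus the `native_decide` certificates inherited from `SAWAdsorptionLowTemperatureSeries.lean` (`cert₅`, `lowP_cert`).
(Lane «pcv-sawmu», a-p3 g12.)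
-/

noncomputable section

open Finset Filter Topology Literature.Probability.LatticeModels SimpleGraph
open scoped BigOperators

namespace Literature.Probability.RandomPlanarGeometry.SAW.Zd

/-! ### The polynomial data of the window (Taylor coefficients in `x = 1/a`) -/

/-- `p(u) = 1 + u² + u³ − u⁴ − 3u⁵`: `e^{κ(a)}/a ≥ p(1/a)` (`a ≥ 3`) and `≤ p(1/a) + 32/a⁶` (`a ≥ 10`).
[cite: JansevanRensburgWhittington2013, §3.1 eq. (3.4) (arXiv v4 p. 6)] -/
def pWin (u : ℝ) : ℝ := 1 + u ^ 2 + u ^ 3 - u ^ 4 - 3 * u ^ 5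

/-- `pA(x) = (1+x²)⁶ (p(y) + 32y⁶)`, `y = x/(1+x²)`. [cite: JansevanRensburgWhittington2013, §3.1 eq. (3.4) (arXiv v4 p. 6)] -/
def pA (x : ℝ) : ℝ := 1 + 7 * x ^ 2 + x ^ 3 + 18 * x ^ 4 + 56 * x ^ 6 + 18 * x ^ 8 + x ^ 9 + 7 * x ^ 10 + x ^ 12

/-- `pN(x) = ((1+x²)⁶ p(x) − pA(x))/x⁴`. [cite: JansevanRensburgWhittington2013, §3.1 eq. (3.4) (arXiv v4 p. 6)] -/
def pN (x : ℝ) : ℝ := 2 + 3 * x - 27 * x ^ 2 - 3 * x ^ 3 + 2 * x ^ 4 - 26 * x ^ 5 - 6 * x ^ 6 - 45 * x ^ 7 - 9 * x ^ 8 -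
  39 * x ^ 9 - 5 * x ^ 10 - 17 * x ^ 11 - x ^ 12 - 3 * x ^ 13

/-- `pM(x) = (pN(x) − 2 pA(x))/x`. [cite: JansevanRensburgWhittington2013, §3.1 eq. (3.4) (arXiv v4 p. 6)] -/
def pM (x : ℝ) : ℝ := 3 - 41 * x - 5 * x ^ 2 - 34 * x ^ 3 - 26 * x ^ 4 - 118 * x ^ 5 - 45 * x ^ 6 - 45 * x ^ 7 - 41 * x ^ 8 -
  19 * x ^ 9 - 17 * x ^ 10 - 3 * x ^ 11 - 3 * x ^ 12

/-- `pD(x) = (p(z) + 32z⁶ − p(x))/x⁴`, `z = x(1+x²)`. [cite: JansevanRensburgWhittington2013, §3.1 eq. (3.4) (arXiv v4 p. 6)] -/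
def pD (x : ℝ) : ℝ := 2 + 3 * x + 29 * x ^ 2 - 12 * x ^ 3 + 186 * x ^ 4 - 29 * x ^ 5 + 476 * x ^ 6 - 30 * x ^ 7 + 639 * x ^ 8 -
  15 * x ^ 9 + 480 * x ^ 10 - 3 * x ^ 11 + 192 * x ^ 12 + 32 * x ^ 14

/-- `pM₂(x) = (pD(x)(1+x²) − 2p(x))/x`. [cite: JansevanRensburgWhittington2013, §3.1 eq. (3.4) (arXiv v4 p. 6)] -/
def pM₂ (x : ℝ) : ℝ := 3 + 29 * x - 11 * x ^ 2 + 217 * x ^ 3 - 35 * x ^ 4 + 662 * x ^ 5 - 59 * x ^ 6 + 1115 * x ^ 7 - 45 * x ^ 8 +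
  1119 * x ^ 9 - 18 * x ^ 10 + 672 * x ^ 11 - 3 * x ^ 12 + 224 * x ^ 13 + 32 * x ^ 15

/-- Lower comparison function `Ψ₁ = (pM − 2x³pN)/(pA + x⁴pN)` (`Ψ₁(0) = 3`). [cite: JansevanRensburgWhittington2013, §3.1 eq. (3.4) (arXiv v4 p. 6)] -/
def lowPsi (x : ℝ) : ℝ := (pM x - 2 * x ^ 3 * pN x) / (pA x + x ^ 4 * pN x)

/-- Upper comparison function `Ψ₂ = pM₂/p` (`Ψ₂(0) = 3`). [cite: JansevanRensburgWhittington2013, §3.1 eq. (3.4) (arXiv v4 p. 6)] -/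
def upPsi (x : ℝ) : ℝ := pM₂ x / pWin x

/-- Identity `(1+x²)⁶ p(x) = pA(x) + x⁴ pN(x)`. [folklore] -/
private theorem pWin_mul (x : ℝ) : pWin x * (1 + x ^ 2) ^ 6 = pA x + x ^ 4 * pN x := by
  unfold pWin pA pN; ring

/-- Identity `(1+x²)⁶ (p(y) + 32y⁶) = pA(x)` for `y = x/(1+x²)`. [folklore] -/
private theorem pWin_y (x : ℝ) : (pWin (x / (1 + x ^ 2)) + 32 * (x / (1 + x ^ 2)) ^ 6) * (1 + x ^ 2) ^ 6 = pA x := by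
  have h : (1 + x ^ 2) ≠ 0 := by positivity
  unfold pWin pA
  field_simp
  ring

/-- Identity `pN − 2pA = x pM`. [folklore] -/
private theorem pN_sub (x : ℝ) : pN x - 2 * pA x = x * pM x := by unfold pN pA pM; ring

/-- Identity `p(z) + 32z⁶ − p(x) = x⁴ pD(x)` for `z = x(1+x²)`. [folklore] -/
private theorem pWin_z (x : ℝ) : pWin (x * (1 + x ^ 2)) + 32 * (x * (1 + x ^ 2)) ^ 6 - pWin x = x ^ 4 * pD x := by
  unfold pWin pD; ring

/-- Identity `pD (1+x²) − 2p = x pM₂`. [folklore] -/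
private theorem pD_mul_sub (x : ℝ) : pD x * (1 + x ^ 2) - 2 * pWin x = x * pM₂ x := by unfold pD pWin pM₂; ring

/-- `pA > 0` on `x ≥ 0`. [folklore] -/
private theorem pA_pos {x : ℝ} (hx : 0 ≤ x) : 0 < pA x := by unfold pA; positivity

/-- `p(x) > 0` for `0 ≤ x ≤ 1/2`. [folklore] -/
private theorem pWin_pos {x : ℝ} (hx : 0 ≤ x) (hx1 : x ≤ 1 / 2) : 0 < pWin x := by
  unfold pWin; nlinarith [pow_nonneg hx 2, pow_nonneg hx 3, pow_le_pow_left₀ hx hx1 4, pow_le_pow_left₀ hx hx1 5]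

/-- `pN(x) > 0` for `0 ≤ x ≤ 1/10`. [folklore] -/
private theorem pN_pos {x : ℝ} (hx : 0 ≤ x) (hx1 : x ≤ 1 / 10) : 0 < pN x := by
  have h1 : x ≤ 1 := hx1.trans (by norm_num)
  have h3 : x ^ 3 ≤ x ^ 2 / 10 := by
    rw [pow_succ]; nlinarith [pow_nonneg hx 2]
  have h2 : x ^ 2 ≤ 1 / 100 := by nlinarith
  have hk : ∀ k : ℕ, 3 ≤ k → x ^ k ≤ x ^ 3 := fun k hk => pow_le_pow_of_le_one hx h1 hk
  have h4 := hk 4 (by norm_num); have h5 := hk 5 (by norm_num); have h6 := hk 6 (by norm_num)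
  have h7 := hk 7 (by norm_num); have h8 := hk 8 (by norm_num); have h9 := hk 9 (by norm_num)
  have h10 := hk 10 (by norm_num); have h11 := hk 11 (by norm_num); have h12 := hk 12 (by norm_num)
  have h13 := hk 13 (by norm_num)
  unfold pN
  nlinarith

/-- `pD(x) > 0` for `0 ≤ x ≤ 1/10`. [folklore] -/
private theorem pD_pos {x : ℝ} (hx : 0 ≤ x) (hx1 : x ≤ 1 / 10) : 0 < pD x := by
  have h1 : x ≤ 1 := hx1.trans (by norm_num)
  have h3 : x ^ 3 ≤ 1 / 1000 := by
    calc x ^ 3 ≤ (1 / 10) ^ 3 := pow_le_pow_left₀ hx hx1 3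
      _ = 1 / 1000 := by norm_num
  have hk : ∀ k : ℕ, 3 ≤ k → x ^ k ≤ x ^ 3 := fun k hk => pow_le_pow_of_le_one hx h1 hk
  have h5 := hk 5 (by norm_num); have h7 := hk 7 (by norm_num); have h9 := hk 9 (by norm_num)
  have h11 := hk 11 (by norm_num)
  unfold pD
  nlinarith [pow_nonneg hx 2, pow_nonneg hx 4, pow_nonneg hx 6, pow_nonneg hx 8, pow_nonneg hx 10, pow_nonneg hx 12,
    pow_nonneg hx 14]

/-- `Ψ₁ → 3` as `x → 0`. [cite: JansevanRensburgWhittington2013, §3.1 eq. (3.4) (arXiv v4 p. 6)] -/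
theorem tendsto_lowPsi : Tendsto lowPsi (𝓝 0) (𝓝 3) := by
  have hc : ContinuousAt lowPsi 0 := by
    unfold lowPsi pM pN pA
    exact ContinuousAt.div (by fun_prop) (by fun_prop) (by norm_num)
  have := hc.tendsto
  rwa [show lowPsi 0 = 3 by norm_num [lowPsi, pM, pN, pA]] at this

/-- `Ψ₂ → 3` as `x → 0`. [cite: JansevanRensburgWhittington2013, §3.1 eq. (3.4) (arXiv v4 p. 6)] -/
theorem tendsto_upPsi : Tendsto upPsi (𝓝 0) (𝓝 3) := by
  have hc : ContinuousAt upPsi 0 := by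
    unfold upPsi pM₂ pWin
    exact ContinuousAt.div (by fun_prop) (by fun_prop) (by norm_num)
  have := hc.tendsto
  rwa [show upPsi 0 = 3 by norm_num [upPsi, pM₂, pWin]] at this

/-- `log (1 + w) ≥ w/(1+w)` for `1 + w > 0`. [folklore] -/
private theorem div_le_log_one_add' {w : ℝ} (hw : 0 < 1 + w) : w / (1 + w) ≤ Real.log (1 + w) := by
  have := Real.one_sub_inv_le_log_of_pos hw
  rwa [show 1 - (1 + w)⁻¹ = w / (1 + w) by field_simp; ring] at this

/-- `log (1 + w) ≤ w` for `1 + w > 0`. [folklore] -/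
private theorem log_one_add_le' {w : ℝ} (hw : 0 < 1 + w) : Real.log (1 + w) ≤ w := by
  have := Real.log_le_sub_one_of_pos hw; linarith

/-! ### The two chord bounds at order `a⁻³` -/

/-- **`Ψ₁(e^{−α}) ≤ e^{3α}(1 − d⁺κ/dα − 2e^{−2α})` for `e^α ≥ 11`** (chord from `a` to `a + 1/a` on the Series window).
[cite: JansevanRensburgWhittington2013, §3.1 eq. (3.4) (arXiv v4 p. 6)] -/
theorem lowPsi_le {α : ℝ} (hα : Real.log 11 ≤ α) :
    lowPsi (Real.exp (-α)) ≤ Real.exp (3 * α) * (1 - rightDensity α - 2 * Real.exp (-2 * α)) := by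
  set x := Real.exp (-α) with hx_def
  set a := Real.exp α with ha_def
  have hx : 0 < x := Real.exp_pos _
  have ha11 : 11 ≤ a := by
    rw [ha_def, ← Real.exp_log (by norm_num : (0:ℝ) < 11)]; exact Real.exp_le_exp.2 hα
  have ha0 : 0 < a := by linarith
  have hax : a = 1 / x := by rw [hx_def, ha_def, Real.exp_neg, one_div, inv_inv]
  have hxa : x = 1 / a := by rw [hax, one_div, one_div, inv_inv]
  have hx1 : x ≤ 1 / 10 := by rw [hxa, div_le_div_iff_of_pos_left one_pos ha0 (by norm_num)]; linarith
  -- the two points `a` and `b = a + 1/a = a(1 + x²)`; `h = log(1 + x²)`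
  set b := a * (1 + x ^ 2) with hb_def
  have hb10 : 10 ≤ b := by rw [hb_def]; nlinarith [pow_nonneg hx.le 2]
  have hb0 : 0 < b := by linarith
  have hx2 : 0 < x ^ 2 := pow_pos hx 2
  have hh : 0 < Real.log (1 + x ^ 2) := Real.log_pos (by linarith)
  have hβ : Real.exp (α + Real.log (1 + x ^ 2)) = b := by
    rw [Real.exp_add, Real.exp_log (by linarith), hb_def]
  -- the window, rewritten with `pWin`
  have hRa : a * pWin x ≤ adsRate a := by
    have h := fourth_order_le_adsRate (show (3:ℝ) ≤ a by linarith)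
    have e : a * pWin x = a + 1 / a + 1 / a ^ 2 - 1 / a ^ 3 - 3 / a ^ 4 := by
      rw [pWin, hxa]; field_simp
    rwa [e]
  have hy : 1 / b = x / (1 + x ^ 2) := by rw [hb_def, hax]; field_simp
  have hRb : adsRate b ≤ b * (pWin (x / (1 + x ^ 2)) + 32 * (x / (1 + x ^ 2)) ^ 6) := by
    have h := adsRate_le_exact5 hb10
    have e : b * (pWin (x / (1 + x ^ 2)) + 32 * (x / (1 + x ^ 2)) ^ 6) =
        b + 1 / b + 1 / b ^ 2 - 1 / b ^ 3 - 3 / b ^ 4 + 32 / b ^ 5 := by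
      rw [← hy, pWin]; field_simp
    rwa [e]
  have hpx : 0 < pWin x := pWin_pos hx.le (hx1.trans (by norm_num))
  have hpy : 0 < pWin (x / (1 + x ^ 2)) + 32 * (x / (1 + x ^ 2)) ^ 6 := by
    have := pWin_y x
    have hA := pA_pos hx.le
    have h6 : 0 < (1 + x ^ 2) ^ 6 := by positivity
    by_contra hneg
    push Not at hneg
    nlinarith [mul_nonpos_of_nonpos_of_nonneg hneg h6.le]
  -- slope bound: `rightDensity α ≤ (κ(α+h) − κ(α))/h ≤ 1 − log(1+W₁)/h`
  have hslope := rightDensity_le_slope (lt_add_of_pos_right α hh)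
  rw [slope_def_field, add_sub_cancel_left] at hslope
  have hκb : adsFreeEnergy (α + Real.log (1 + x ^ 2)) ≤
      (α + Real.log (1 + x ^ 2)) + Real.log (pWin (x / (1 + x ^ 2)) + 32 * (x / (1 + x ^ 2)) ^ 6) := by
    rw [adsFreeEnergy, hβ]
    calc Real.log (adsRate b) ≤ Real.log (b * (pWin (x / (1 + x ^ 2)) + 32 * (x / (1 + x ^ 2)) ^ 6)) :=
          Real.log_le_log (adsRate_pos hb0.le) hRb
      _ = _ := by rw [Real.log_mul hb0.ne' hpy.ne', ← hβ, Real.log_exp]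
  have hκa : α + Real.log (pWin x) ≤ adsFreeEnergy α := by
    rw [adsFreeEnergy, ← ha_def]
    calc α + Real.log (pWin x) = Real.log (a * pWin x) := by rw [Real.log_mul ha0.ne' hpx.ne', ha_def, Real.log_exp]
      _ ≤ Real.log (adsRate a) := Real.log_le_log (by positivity) hRa
  -- `1 + W₁ = p(x)/(p(y)+32y⁶) = (pA + x⁴pN)/pA`
  have hW : pWin x / (pWin (x / (1 + x ^ 2)) + 32 * (x / (1 + x ^ 2)) ^ 6) = 1 + x ^ 4 * pN x / pA x := by
    have h6 : (1 + x ^ 2) ^ 6 ≠ 0 := by positivity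
    have hA := (pA_pos hx.le).ne'
    rw [show pWin x = (pA x + x ^ 4 * pN x) / (1 + x ^ 2) ^ 6 by rw [← pWin_mul]; field_simp,
      show pWin (x / (1 + x ^ 2)) + 32 * (x / (1 + x ^ 2)) ^ 6 = pA x / (1 + x ^ 2) ^ 6 by rw [← pWin_y]; field_simp]
    field_simp
  have hN := pN_pos hx.le hx1
  have hWpos : 0 < x ^ 4 * pN x / pA x := div_pos (by positivity) (pA_pos hx.le)
  have hlogW : Real.log (1 + x ^ 4 * pN x / pA x) =
      Real.log (pWin x) - Real.log (pWin (x / (1 + x ^ 2)) + 32 * (x / (1 + x ^ 2)) ^ 6) := by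
    rw [← hW, Real.log_div hpx.ne' hpy.ne']
  have key : Real.log (1 + x ^ 4 * pN x / pA x) / Real.log (1 + x ^ 2) ≤ 1 - rightDensity α := by
    rw [div_le_iff₀ hh, hlogW]
    have := mul_le_mul_of_nonneg_right hslope hh.le
    rw [div_mul_cancel₀ _ hh.ne'] at this
    nlinarith
  -- lower the left side: `log(1+W) ≥ W/(1+W)`, `log(1+x²) ≤ x²`
  have hlow : x ^ 2 * pN x / (pA x + x ^ 4 * pN x) ≤ Real.log (1 + x ^ 4 * pN x / pA x) / Real.log (1 + x ^ 2) := by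
    rw [le_div_iff₀ hh]
    have h1 := div_le_log_one_add' (show 0 < 1 + x ^ 4 * pN x / pA x by linarith)
    have h2 := log_one_add_le' (show 0 < 1 + x ^ 2 by linarith)
    have hA := pA_pos hx.le
    have h3 : 0 ≤ x ^ 2 * pN x / (pA x + x ^ 4 * pN x) := by positivity
    calc x ^ 2 * pN x / (pA x + x ^ 4 * pN x) * Real.log (1 + x ^ 2)
        ≤ x ^ 2 * pN x / (pA x + x ^ 4 * pN x) * x ^ 2 := mul_le_mul_of_nonneg_left h2 h3
      _ = (x ^ 4 * pN x / pA x) / (1 + x ^ 4 * pN x / pA x) := by field_simp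
      _ ≤ Real.log (1 + x ^ 4 * pN x / pA x) := h1
  -- assemble: `e^{3α}(1 − E − 2x²) = ((1 − E) − 2x²)/x³ ≥ (x²pN/(pA + x⁴pN) − 2x²)/x³ = Ψ₁`
  have he3 : Real.exp (3 * α) = 1 / x ^ 3 := by
    rw [hx_def, ← Real.exp_nat_mul, one_div, ← Real.exp_neg]; ring_nf
  have he2 : Real.exp (-2 * α) = x ^ 2 := by
    rw [hx_def, ← Real.exp_nat_mul]; ring_nf
  have hden : 0 < pA x + x ^ 4 * pN x := by have := pA_pos hx.le; positivity
  have hΨ : lowPsi x = 1 / x ^ 3 * (x ^ 2 * pN x / (pA x + x ^ 4 * pN x) - 2 * x ^ 2) := by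
    have hxne : x ≠ 0 := hx.ne'
    have hM : pM x = (pN x - 2 * pA x) / x := by rw [pN_sub]; field_simp
    rw [lowPsi, hM]
    set D := pA x + x ^ 4 * pN x with hD
    have hDne : D ≠ 0 := hden.ne'
    have hpA : pA x = D - x ^ 4 * pN x := by rw [hD]; ring
    rw [hpA]
    field_simp
    ring
  rw [he3, he2, hΨ]
  exact mul_le_mul_of_nonneg_left (by linarith [hlow.trans key]) (by positivity)

/-- **`e^{3α}(1 − d⁻κ/dα − 2e^{−2α}) ≤ Ψ₂(e^{−α})` for `e^α ≥ 11`** (chord from `a/(1 + a⁻²)` to `a` on the Series window).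
[cite: JansevanRensburgWhittington2013, §3.1 eq. (3.4) (arXiv v4 p. 6)] -/
theorem le_upPsi {α : ℝ} (hα : Real.log 11 ≤ α) :
    Real.exp (3 * α) * (1 - leftDensity α - 2 * Real.exp (-2 * α)) ≤ upPsi (Real.exp (-α)) := by
  set x := Real.exp (-α) with hx_def
  set a := Real.exp α with ha_def
  have hx : 0 < x := Real.exp_pos _
  have ha11 : 11 ≤ a := by
    rw [ha_def, ← Real.exp_log (by norm_num : (0:ℝ) < 11)]; exact Real.exp_le_exp.2 hα
  have ha0 : 0 < a := by linarith
  have hax : a = 1 / x := by rw [hx_def, ha_def, Real.exp_neg, one_div, inv_inv]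
  have hxa : x = 1 / a := by rw [hax, one_div, one_div, inv_inv]
  have hx1 : x ≤ 1 / 10 := by rw [hxa, div_le_div_iff_of_pos_left one_pos ha0 (by norm_num)]; linarith
  have hx2 : 0 < x ^ 2 := pow_pos hx 2
  -- the two points `c = a/(1+x²)` and `a`; `h = log(1+x²)`; `1/c = x(1+x²)`
  set c := a / (1 + x ^ 2) with hc_def
  have h1x : 0 < 1 + x ^ 2 := by linarith
  have hc10 : 10 ≤ c := by
    rw [hc_def, le_div_iff₀ h1x]
    have : x ^ 2 ≤ 1 / 100 := by nlinarith
    nlinarith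
  have hc0 : 0 < c := by linarith
  have hh : 0 < Real.log (1 + x ^ 2) := Real.log_pos (by linarith)
  have hγ : Real.exp (α - Real.log (1 + x ^ 2)) = c := by
    rw [Real.exp_sub, Real.exp_log h1x, hc_def]
  have hz : 1 / c = x * (1 + x ^ 2) := by rw [hc_def, hax]; field_simp
  -- window: lower at `a`, upper at `c`
  have hRa : a * pWin x ≤ adsRate a := by
    have h := fourth_order_le_adsRate (show (3:ℝ) ≤ a by linarith)
    have e : a * pWin x = a + 1 / a + 1 / a ^ 2 - 1 / a ^ 3 - 3 / a ^ 4 := by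
      rw [pWin, hxa]; field_simp
    rwa [e]
  have hRc : adsRate c ≤ c * (pWin (x * (1 + x ^ 2)) + 32 * (x * (1 + x ^ 2)) ^ 6) := by
    have h := adsRate_le_exact5 hc10
    have e : c * (pWin (x * (1 + x ^ 2)) + 32 * (x * (1 + x ^ 2)) ^ 6) =
        c + 1 / c + 1 / c ^ 2 - 1 / c ^ 3 - 3 / c ^ 4 + 32 / c ^ 5 := by
      rw [← hz, pWin]; field_simp
    rwa [e]
  have hpx : 0 < pWin x := pWin_pos hx.le (hx1.trans (by norm_num))
  have hD := pD_pos hx.le hx1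
  have hpz : pWin (x * (1 + x ^ 2)) + 32 * (x * (1 + x ^ 2)) ^ 6 = pWin x + x ^ 4 * pD x := by
    have := pWin_z x; linarith
  have hpz0 : 0 < pWin (x * (1 + x ^ 2)) + 32 * (x * (1 + x ^ 2)) ^ 6 := by rw [hpz]; positivity
  have hslope := slope_le_leftDensity (sub_lt_self α hh)
  rw [slope_def_field, sub_sub_cancel] at hslope
  have hκc : adsFreeEnergy (α - Real.log (1 + x ^ 2)) ≤ (α - Real.log (1 + x ^ 2)) + Real.log (pWin x + x ^ 4 * pD x) := by
    rw [adsFreeEnergy, hγ, ← hpz]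
    calc Real.log (adsRate c) ≤ Real.log (c * (pWin (x * (1 + x ^ 2)) + 32 * (x * (1 + x ^ 2)) ^ 6)) :=
          Real.log_le_log (adsRate_pos hc0.le) hRc
      _ = _ := by rw [Real.log_mul hc0.ne' hpz0.ne', ← hγ, Real.log_exp]
  have hκa : α + Real.log (pWin x) ≤ adsFreeEnergy α := by
    rw [adsFreeEnergy, ← ha_def]
    calc α + Real.log (pWin x) = Real.log (a * pWin x) := by rw [Real.log_mul ha0.ne' hpx.ne', ha_def, Real.log_exp]
      _ ≤ Real.log (adsRate a) := Real.log_le_log (by positivity) hRa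
  -- `1 + W₂ = (p + x⁴ pD)/p`
  have hWpos : 0 < x ^ 4 * pD x / pWin x := by positivity
  have hlogW : Real.log (1 + x ^ 4 * pD x / pWin x) = Real.log (pWin x + x ^ 4 * pD x) - Real.log (pWin x) := by
    rw [← Real.log_div (by positivity) hpx.ne']
    congr 1
    field_simp
  have key : 1 - leftDensity α ≤ Real.log (1 + x ^ 4 * pD x / pWin x) / Real.log (1 + x ^ 2) := by
    rw [le_div_iff₀ hh, hlogW]
    have := mul_le_mul_of_nonneg_right hslope hh.le
    rw [div_mul_cancel₀ _ hh.ne'] at this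
    nlinarith
  -- raise the right side: `log(1+W) ≤ W`, `log(1+x²) ≥ x²/(1+x²)`
  have hup : Real.log (1 + x ^ 4 * pD x / pWin x) / Real.log (1 + x ^ 2) ≤ x ^ 2 * pD x * (1 + x ^ 2) / pWin x := by
    rw [div_le_iff₀ hh]
    have h1 := log_one_add_le' (show 0 < 1 + x ^ 4 * pD x / pWin x by linarith)
    have h2 := div_le_log_one_add' (show 0 < 1 + x ^ 2 by linarith)
    calc Real.log (1 + x ^ 4 * pD x / pWin x) ≤ x ^ 4 * pD x / pWin x := h1
      _ = x ^ 2 * pD x * (1 + x ^ 2) / pWin x * (x ^ 2 / (1 + x ^ 2)) := by field_simp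
      _ ≤ x ^ 2 * pD x * (1 + x ^ 2) / pWin x * Real.log (1 + x ^ 2) :=
          mul_le_mul_of_nonneg_left h2 (by positivity)
  have he3 : Real.exp (3 * α) = 1 / x ^ 3 := by
    rw [hx_def, ← Real.exp_nat_mul, one_div, ← Real.exp_neg]; ring_nf
  have he2 : Real.exp (-2 * α) = x ^ 2 := by
    rw [hx_def, ← Real.exp_nat_mul]; ring_nf
  have hΨ : upPsi x = 1 / x ^ 3 * (x ^ 2 * pD x * (1 + x ^ 2) / pWin x - 2 * x ^ 2) := by
    have hxne : x ≠ 0 := hx.ne'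
    have hpxne : pWin x ≠ 0 := hpx.ne'
    have hM : pM₂ x = (pD x * (1 + x ^ 2) - 2 * pWin x) / x := by rw [pD_mul_sub]; field_simp
    rw [upPsi, hM]
    field_simp
  rw [he3, he2, hΨ]
  exact mul_le_mul_of_nonneg_left (by linarith [key.trans hup]) (by positivity)

/-! ### The second-order law -/

/-- **`e^{3α}(1 − d⁺κ/dα − 2e^{−2α}) → 3` as `α → ∞`.** [cite: JansevanRensburgWhittington2013, §3.1 eq. (3.4) (arXiv v4 p. 6)] -/
theorem tendsto_exp_three_mul_rightDensity :
    Tendsto (fun α : ℝ => Real.exp (3 * α) * (1 - rightDensity α - 2 * Real.exp (-2 * α))) atTop (𝓝 3) := by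
  have hx : Tendsto (fun α : ℝ => Real.exp (-α)) atTop (𝓝 0) := Real.tendsto_exp_neg_atTop_nhds_zero
  have hlow : Tendsto (fun α : ℝ => lowPsi (Real.exp (-α))) atTop (𝓝 3) := tendsto_lowPsi.comp hx
  have hup : Tendsto (fun α : ℝ => upPsi (Real.exp (-α))) atTop (𝓝 3) := tendsto_upPsi.comp hx
  have hmid : ∀ α : ℝ, Real.exp (3 * α) * (1 - rightDensity α - 2 * Real.exp (-2 * α)) ≤
      Real.exp (3 * α) * (1 - leftDensity α - 2 * Real.exp (-2 * α)) := fun α =>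
    mul_le_mul_of_nonneg_left (by linarith [leftDensity_le_rightDensity α]) (Real.exp_pos _).le
  refine tendsto_of_tendsto_of_tendsto_of_le_of_le' hlow hup ?_ ?_
  · filter_upwards [eventually_ge_atTop (Real.log 11)] with α hα using lowPsi_le hα
  · filter_upwards [eventually_ge_atTop (Real.log 11)] with α hα using (hmid α).trans (le_upPsi hα)

/-- **`e^{3α}(1 − d⁻κ/dα − 2e^{−2α}) → 3` as `α → ∞`.** [cite: JansevanRensburgWhittington2013, §3.1 eq. (3.4) (arXiv v4 p. 6)] -/
theorem tendsto_exp_three_mul_leftDensity :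
    Tendsto (fun α : ℝ => Real.exp (3 * α) * (1 - leftDensity α - 2 * Real.exp (-2 * α))) atTop (𝓝 3) := by
  have hx : Tendsto (fun α : ℝ => Real.exp (-α)) atTop (𝓝 0) := Real.tendsto_exp_neg_atTop_nhds_zero
  have hlow : Tendsto (fun α : ℝ => lowPsi (Real.exp (-α))) atTop (𝓝 3) := tendsto_lowPsi.comp hx
  have hup : Tendsto (fun α : ℝ => upPsi (Real.exp (-α))) atTop (𝓝 3) := tendsto_upPsi.comp hx
  have hmid : ∀ α : ℝ, Real.exp (3 * α) * (1 - rightDensity α - 2 * Real.exp (-2 * α)) ≤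
      Real.exp (3 * α) * (1 - leftDensity α - 2 * Real.exp (-2 * α)) := fun α =>
    mul_le_mul_of_nonneg_left (by linarith [leftDensity_le_rightDensity α]) (Real.exp_pos _).le
  refine tendsto_of_tendsto_of_tendsto_of_le_of_le' hlow hup ?_ ?_
  · filter_upwards [eventually_ge_atTop (Real.log 11)] with α hα using (lowPsi_le hα).trans (hmid α)
  · filter_upwards [eventually_ge_atTop (Real.log 11)] with α hα using le_upPsi hα

/-- **In the fugacity: `a³(1 − 𝓔_+(a) − 2/a²) → 3`** — the fraction of monomers off the wall is `2/a² + 3/a³ + o(a⁻³)`.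
[cite: JansevanRensburgWhittington2013, §3.1 eq. (3.4) (arXiv v4 p. 6)] -/
theorem tendsto_cube_mul_one_sub_rightDensity_log :
    Tendsto (fun a : ℝ => a ^ 3 * (1 - rightDensity (Real.log a) - 2 / a ^ 2)) atTop (𝓝 3) := by
  refine ((tendsto_exp_three_mul_rightDensity.comp Real.tendsto_log_atTop).congr' ?_)
  filter_upwards [eventually_gt_atTop 0] with a ha
  simp only [Function.comp]
  rw [show (3 : ℝ) * Real.log a = ((3 : ℕ) : ℝ) * Real.log a by norm_num, ← Real.log_pow, Real.exp_log (pow_pos ha 3),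
    show (-2 : ℝ) * Real.log a = -(((2 : ℕ) : ℝ) * Real.log a) by norm_num, Real.exp_neg, ← Real.log_pow,
    Real.exp_log (pow_pos ha 2), div_eq_mul_inv]

/-- **In the fugacity: `a³(1 − 𝓔_-(a) − 2/a²) → 3`.** [cite: JansevanRensburgWhittington2013, §3.1 eq. (3.4) (arXiv v4 p. 6)] -/
theorem tendsto_cube_mul_one_sub_leftDensity_log :
    Tendsto (fun a : ℝ => a ^ 3 * (1 - leftDensity (Real.log a) - 2 / a ^ 2)) atTop (𝓝 3) := by
  refine ((tendsto_exp_three_mul_leftDensity.comp Real.tendsto_log_atTop).congr' ?_)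
  filter_upwards [eventually_gt_atTop 0] with a ha
  simp only [Function.comp]
  rw [show (3 : ℝ) * Real.log a = ((3 : ℕ) : ℝ) * Real.log a by norm_num, ← Real.log_pow, Real.exp_log (pow_pos ha 3),
    show (-2 : ℝ) * Real.log a = -(((2 : ℕ) : ℝ) * Real.log a) by norm_num, Real.exp_neg, ← Real.log_pow,
    Real.exp_log (pow_pos ha 2), div_eq_mul_inv]

end Literature.Probability.RandomPlanarGeometry.SAW.Zd
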